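import Mathlib.Topology.Separation.Basic
import Literature.AlgebraicGeometry.Resolution.CanonicalResolutionProofs
import Literature.AlgebraicGeometry.Resolution.BlowupsFlatBaseChange
import Literature.AlgebraicGeometry.Resolution.ResolutionOfSingularities

/-!
# ResolutionOfSingularities / WeightedInvariant — `WeightedThesis`, line `kunz-tower-exceptional-defect`:
local-to-global step

Support file for `stmt-ResolutionOfSingularities-0569` (stub `stub_localToGlobal` of the lead
skeleton). For a tower `X₀ ← X 0 ← X 1 ← …` of proper `X₀`-schemes (`ρ n : X n ⟶ X₀` the
composites, `π n : X (n+1) ⟶ X n` the steps, `π n ≫ ρ n = ρ (n+1)`) whose steps are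
isomorphisms over every open contained in the regular locus, over a base `X₀` quasi-compact and
locally of finite type over a field: if over every CLOSED point of `X₀` some stage is regular,
then some stage `X n` is (globally) regular.

Proof (folklore). Put `G n := {x ∈ X₀ | every y over x is a regular point of X n}
= X₀ ∖ ρ n (X n ∖ Reg (X n))`.
* `G n` is open: `Reg (X n)` is open (`isOpen_regularLocus_of_locallyOfFiniteType_field`, the
  composite `ρ n ≫ f` being locally of finite type) and `ρ n` is a closed map (proper).
* `G n ⊆ G (n+1)`: the step `π n` is an isomorphism over `Reg (X n)`, and local rings do not
  change there (`mem_regularLocus_iff_of_isIso_morphismRestrict`).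
* `⋃ G n = X₀`: otherwise the nonempty closed complement contains a closed point of the compact
  `T₀` space `X₀` (`IsClosed.exists_closed_singleton`), contradicting the pointwise hypothesis.
* `X₀` is compact and the cover is directed, so `G N = X₀` for some `N`, i.e. `X N` is regular.
-/

-- single-problem summit: the doubled namespace component `ResolutionOfSingularities` is forced
set_option linter.dupNamespace false

namespace Summit.ResolutionOfSingularities.ResolutionOfSingularities.Theorems.WeightedThesis.KunzTower

open CategoryTheory AlgebraicGeometry TopologicalSpace Literature.AlgebraicGeometry.Resolution

/-- **Local-to-global step of the normalised F-blowup tower argument** (stub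
`stub_localToGlobal`, line `kunz-tower-exceptional-defect` of `WeightedThesis`): for a tower of
proper `X₀`-schemes whose steps are isomorphisms over the regular loci, over `X₀` quasi-compact
and locally of finite type over a field, eventual regularity over every closed point of `X₀`
forces some stage to be regular (openness of `Reg`, closedness of proper maps, existence of closed
points in compact `T₀` spaces, quasi-compactness). [folklore] -/
theorem stub_localToGlobal :
    ∀ (k : Type) [Field k] (X₀ : Scheme.{0}) (f : X₀ ⟶ Spec (.of k)) [IsIntegral X₀]
      [IsSeparated f] [LocallyOfFiniteType f] [QuasiCompact f]
      (X : ℕ → Scheme.{0}) (ρ : ∀ n, X n ⟶ X₀) (π : ∀ n, X (n + 1) ⟶ X n),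
      (∀ n, π n ≫ ρ n = ρ (n + 1)) → (∀ n, IsProper (ρ n)) →
      (∀ n (U : (X n).Opens), (U : Set (X n)) ⊆ Scheme.regularLocus (X n) → IsIso (π n ∣_ U)) →
      (∀ x : X₀, IsClosed ({x} : Set X₀) →
          ∃ n, ∀ y : X n, ρ n y = x → y ∈ Scheme.regularLocus (X n)) →
      ∃ n, Scheme.IsRegular (X n) := by
  intro k _ X₀ f _ _ _ _ X ρ π hρ hproper hiso hpt
  -- the good loci `G n = X₀ ∖ ρ n (X n ∖ Reg (X n))`
  let G : ℕ → Set X₀ := fun n => ((ρ n).base '' (Scheme.regularLocus (X n))ᶜ)ᶜ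
  have hGmem : ∀ n (x : X₀), x ∈ G n ↔ ∀ y : X n, ρ n y = x → y ∈ Scheme.regularLocus (X n) := by
    intro n x
    simp only [G, Set.mem_compl_iff, Set.mem_image, not_exists, not_and]
    exact ⟨fun h y hy => not_not.mp fun hy' => h y hy' hy, fun h y hy' hy => hy' (h y hy)⟩
  -- (a) each `G n` is open
  have hGopen : ∀ n, IsOpen (G n) := by
    intro n
    haveI := hproper n
    have hreg : IsOpen (Scheme.regularLocus (X n)) :=
      isOpen_regularLocus_of_locallyOfFiniteType_field (ρ n ≫ f)
    exact ((ρ n).isClosedMap _ hreg.isClosed_compl).isOpen_compl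
  -- (b) the `G n` increase
  have hGmono : Monotone G := by
    refine monotone_nat_of_le_succ fun n => ?_
    intro x hx
    rw [hGmem] at hx ⊢
    intro y' hy'
    haveI := hproper n
    let U : (X n).Opens :=
      ⟨Scheme.regularLocus (X n), isOpen_regularLocus_of_locallyOfFiniteType_field (ρ n ≫ f)⟩
    haveI : IsIso (π n ∣_ U) := hiso n U subset_rfl
    have hy : π n y' ∈ Scheme.regularLocus (X n) := by
      refine hx _ ?_
      rw [← Scheme.Hom.comp_apply, hρ]
      exact hy'
    exact (mem_regularLocus_iff_of_isIso_morphismRestrict (π n) U y' hy).mpr hy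
  -- (c) the `G n` cover `X₀`
  haveI : CompactSpace X₀ := QuasiCompact.compactSpace_of_compactSpace f
  have hGcover : (Set.univ : Set X₀) ⊆ ⋃ n, G n := by
    intro x _
    by_contra hxG
    have hC : IsClosed (⋃ n, G n)ᶜ := (isOpen_iUnion hGopen).isClosed_compl
    obtain ⟨z, hzC, hz⟩ := hC.exists_closed_singleton ⟨x, hxG⟩
    obtain ⟨n, hn⟩ := hpt z hz
    exact hzC (Set.mem_iUnion.mpr ⟨n, (hGmem n z).mpr hn⟩)
  -- (d) compactness: one `G N` is everything
  obtain ⟨N, hN⟩ := isCompact_univ.elim_directed_cover G hGopen hGcover hGmono.directed_le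
  refine ⟨N, fun y => ?_⟩
  exact (hGmem N (ρ N y)).mp (hN (Set.mem_univ _)) y rfl

end Summit.ResolutionOfSingularities.ResolutionOfSingularities.Theorems.WeightedThesis.KunzTower
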